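import Summits.BirchSwinnertonDyer.BirchSwinnertonDyer.Theorems.ErratumRoadFiveBigRepInvariants
import Literature.NumberTheory.EllipticCurves.BigGaloisRepSelmer
import Literature.NumberTheory.EllipticCurves.PrimaryTorsionGaloisRep
import Literature.NumberTheory.EllipticCurves.ZpExtensionUnramifiedProofs
import HarnessLib

/-!
# K2 crux 19270 `IMCDivAtErratumDataAll` (H3♭), ROAD FF — the Lemma-2.1 hypotheses of the glue
# `XAc.map_charIdeal_le_span_of_roadFF_unr_le` (p477148) AT THE ERRATUM's LOCAL DATA
# `ψ = localMap K`, `L₀ = strictSet p 𝔮 Σ` (defn-ty1's `BigGaloisRepSelmer`, p478886), for every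
# `AnticyclotomicBigGaloisRep κ ρ` and for `M_f = W.anticyclotomicBigRep p κ` (E[p^∞], p478886's sequel)

Cell `bsd-stepL`, seat `bsd-stepL-imc-p1` (g8). `--supports stmt-BirchSwinnertonDyer-19270 --as helper`.
HONEST FRAMING: BSD is not proved for any pair by this file; it closes no item; no definition, no
named fact, no `sorry`. Sequel of p479748 (`ErratumRoadFiveBigRepInvariants`: the criteria for an
abstract family `ψ`, `L₀`), instantiated at the objects that landed tonight:
`Literature/…/BigGaloisRepSelmer.lean` (`localMap K`, `strictSet p 𝔮 Σ`, `selmerBig`) and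
`Literature/…/PrimaryTorsionGaloisRep.lean` (`W.primaryTorsionGaloisRep p`, `W.anticyclotomicBigRep p κ`).

## What this file proves

The erratum's Selmer group is `Sel^Σ_𝔭(K, M) = ker{H¹(G_{K,S}, M) → H¹(K_𝔭, M)}`, `S = Σ ∪ S_p`
(Lemma 2.1, p. 2), i.e. the kernel's `TorsionControl.selmer (localMap K) (strictSet p 𝔮 Σ) M`
with constrained indices: DECOMPOSITION at the strict prime `𝔮` (`Sum.inl 𝔮`) and INERTIA at every
finite `w ∉ Σ`, `w ∤ p` (`Sum.inr w`). Lemma 2.1 (`selmerTorsionEquiv`, consumed by the glue in the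
divisible-invariants shape `hloc`) needs `p^m`-divisible local invariants at each of them:

* §1 **`kappa_absGaloisRestrict_eq_one_of_mem_absInertia`** ∕ **`kappa_localMap_inr_eq_one`**:
  EVERY `ℤ_p`-extension `κ` of `K` kills the inertia group at `w ∤ p` (the tree's
  `apply_eq_one_of_mem_absInertia` — tame inertia is killed by `q − 1`, wild inertia is pro-`ℓ` —
  and `ringChar_residueField_adicCompletion_ne`), in `localMap` currency.
* §2 **`divisibleInvariants_localMap_strictSet`** — `hloc` for `M = AnticyclotomicBigGaloisRep κ ρ`
  at `(localMap K, strictSet p 𝔮 Σ)` from TWO arithmetic inputs on the discrete `A`: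
  (dec) no nonzero `Γ_{K_𝔮}`-fixed `p`-power torsion in `A` ("vanishes when so does
  `H⁰(K_𝔭, A_g[ϖ])`", erratum p. 2; for `E`: (iv) `E(ℚ_p)[p] = 0`), and
  (unr) `A` is unramified at every `w ∉ Σ`, `w ∤ p` ("Suppose `Σ` contains all primes `v ∤ p` where
  `T_g` is ramified", Lemma 2.1) — by cases `Sum.inl ∕ Sum.inr` on p479748's
  `divisibleInvariants_bigRep_restrict_of_cases`, §1 supplying `κ ∘ ψ_w = 1`;
  **`divisibleInvariants_anticyclotomicBigGaloisRep`** (`hglob`) restated at the specialisation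
  (`hdiv` is p479748's `C_smul_surjective` verbatim).
* §3 the `E`-instance `M_f = W.anticyclotomicBigRep p κ` (`A = E[p^∞] = PrimaryTorsion (W.geomPoints) p`,
  `𝒪 = ℤ_p`), hypotheses in the language of GEOMETRIC POINTS:
  **`hdiv_anticyclotomicBigRep`** ⟸ `E(K̄)` is `p`-divisible;
  **`hglob_anticyclotomicBigRep`** ⟸ no nonzero `Γ_K`-fixed point of `E[p^∞]` (`E(K)[p] = 0`);
  **`hloc_anticyclotomicBigRep`** ⟸ no nonzero `Γ_{K_𝔮}`-fixed point of `E[p^∞]` (`E(K_𝔮)[p] = 0`,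
  (iv)) ∧ inertia at `w ∉ Σ`, `w ∤ p` acts trivially on `E[p^∞]` (good reduction outside `Σ ∪ S_p`,
  Néron–Ogg–Shafarevich); and the reduction **`eq_zero_of_forall_fixed_of_torsionBy`**: "no fixed
  `p`-power torsion" ⟸ "no fixed `p`-torsion" (multiply a fixed `p^{k+1}`-torsion point by `p^k`).

Pure algebra ∕ bookkeeping on the constructed objects; CONDITIONAL on nothing; closes nothing. The
three arithmetic inputs (divisibility of `E(K̄)`, `E(K)[p] = E(K_𝔭)[p] = 0`, unramifiedness outside
`Σ ∪ S_p`) are left as hypotheses in their natural form (they are theorems ∕ cited facts elsewhere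
in the tree and are discharged at the erratum data by the assembly file).

References: [Castella2018Erratum] §2, Lemma 2.1 and its proof (p. 2); [Castella2018] §2.1 Def. 2.2,
proof of Thm. 2.6; [Skinner2016PacificMC] §2.3 Lemma 2.3.1 (p. 180); [SerreLocalFields1979] IV §2
(tame ∕ wild inertia); [Washington1997] Prop. 13.2 (`ℤ_p`-extensions are unramified outside `p`).
-/

noncomputable section

open PowerSeries Field IsDedekindDomain NumberField
  Literature.NumberTheory.GaloisRepresentations Literature.NumberTheory.EllipticCurves
  Literature.NumberTheory.EllipticCurves.BigRepModule Literature.NumberTheory.EllipticCurves.BigGaloisRep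

universe u

namespace Summit.BirchSwinnertonDyer.Rank1Residual.X11b.BigRep

variable {K : Type u} [Field K] [NumberField K] {p : ℕ} [Fact p.Prime]

/-! ### §1 `ℤ_p`-extensions are unramified outside `p`, in `localMap` currency -/

/-- **Every `ℤ_p`-extension `κ` of `K` kills the inertia group at a finite place `w ∤ p`**:
`κ(σ) = 1` for `σ ∈ I_{K_w} ⊂ Γ_{K_w} → Γ_K` (the tree's `apply_eq_one_of_mem_absInertia`: a
continuous `χ : Γ_{K_w} → ℤ_p` kills inertia when the residue characteristic is `≠ p` — tame
inertia is killed by `q − 1` in the torsion-free `ℤ_p`, wild inertia is pro-`ℓ`; residue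
characteristic `≠ p` by `ringChar_residueField_adicCompletion_ne`).
[cite: Washington1997, Prop. 13.2] [cite: SerreLocalFields1979, Ch. IV §2 Prop. 7, Cor. 1–3] -/
theorem kappa_absGaloisRestrict_eq_one_of_mem_absInertia (κ : ZpExtension K p)
    {w : HeightOneSpectrum (𝓞 K)} (hw : ((p : ℕ) : 𝓞 K) ∉ w.asIdeal)
    {σ : absoluteGaloisGroup (w.adicCompletion K)} (hσ : σ ∈ absInertia (w.adicCompletion K)) :
    κ (absGaloisRestrict K (w.adicCompletion K) σ) = 1 :=
  apply_eq_one_of_mem_absInertia (w.ringChar_residueField_adicCompletion_ne hw)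
    (κ.toContinuousMonoidHom.comp (absGaloisRestrict K (w.adicCompletion K))) hσ

/-- The same along defn-ty1's local map at an INERTIA index: `κ ∘ localMap K (Sum.inr w) = 1` for
`w ∤ p`. [cite: Washington1997, Prop. 13.2] -/
theorem kappa_localMap_inr_eq_one (κ : ZpExtension K p) {w : HeightOneSpectrum (𝓞 K)}
    (hw : ((p : ℕ) : 𝓞 K) ∉ w.asIdeal) (h : LocalGroup K (Sum.inr w)) :
    κ.toContinuousMonoidHom (localMap K (Sum.inr w) h) = 1 := by
  obtain ⟨σ, hσ⟩ := h
  exact kappa_absGaloisRestrict_eq_one_of_mem_absInertia κ hw hσ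

/-! ### §2 `hloc` ∕ `hglob` ∕ `hdiv` for `AnticyclotomicBigGaloisRep κ ρ` at `(localMap K, strictSet p 𝔮 Σ)` -/

section Generic

variable {𝒪 : Type*} [CommRing 𝒪] [TopologicalSpace 𝒪]
  {A : Type u} [AddCommGroup A] [Module 𝒪 A] [TopologicalSpace A] [DiscreteTopology A]
  [TopologicalSpace (PowerSeries 𝒪)] [ContinuousSMul (PowerSeries 𝒪) (BigRepModule 𝒪 p A)]

/-- **`hloc` at the erratum's local data.** For `M = AnticyclotomicBigGaloisRep κ ρ = T ⊗_𝒪 Λ_𝒪^*(Ψ⁻¹)`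
and the strict set of `Sel^Σ_𝔮(K, M) = ker{H¹(G_{K,S}, M) → H¹(K_𝔮, M)}` (`S = Σ ∪ S_p`): the
constrained local invariants are `p^m`-divisible for every `m ≥ 1`, PROVIDED (dec) `A` has no
nonzero `Γ_{K_𝔮}`-fixed `p`-power torsion ("vanishes when so does `H⁰(K_𝔭, A_g[ϖ])`") and (unr)
`A` is unramified at every finite `w ∉ Σ`, `w ∤ p` ("`Σ` contains all primes `v ∤ p` where `T_g` is
ramified") and `p`-divisible (`A = V/T`). At `Sum.inl 𝔮`: the invariants vanish (p479748 §2); at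
`Sum.inr w`: `M|_{I_w}` is trivial (§1 + (unr)), its invariants are all of `M`, `p^m`-divisible.
[cite: Castella2018Erratum, Lemma 2.1 and its proof (p. 2)] -/
theorem divisibleInvariants_localMap_strictSet (κ : ZpExtension K p)
    (ρ : ContinuousRep (absoluteGaloisGroup K) 𝒪 A) (𝔮 : HeightOneSpectrum (𝓞 K))
    (S : Set (HeightOneSpectrum (𝓞 K)))
    (hdiv : ∀ a : A, (∃ k : ℕ, p ^ k • a = 0) → ∃ b : A, p • b = a)
    (hdec : ∀ a : A, (∀ σ : absoluteGaloisGroup (𝔮.adicCompletion K),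
        ρ (absGaloisRestrict K (𝔮.adicCompletion K) σ) a = a) → (∃ k : ℕ, p ^ k • a = 0) → a = 0)
    (hunr : ∀ w : HeightOneSpectrum (𝓞 K), w ∉ S → ((p : ℕ) : 𝓞 K) ∉ w.asIdeal →
      ∀ σ : absoluteGaloisGroup (w.adicCompletion K), σ ∈ absInertia (w.adicCompletion K) →
        ∀ a : A, ρ (absGaloisRestrict K (w.adicCompletion K) σ) a = a) :
    ∀ m : ℕ, 1 ≤ m → ∀ v ∈ strictSet p 𝔮 S,
      ∀ x ∈ (((AnticyclotomicBigGaloisRep κ ρ).restrict (localMap K v)).toTopRep).ρ.invariants,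
        ∃ x' ∈ (((AnticyclotomicBigGaloisRep κ ρ).restrict (localMap K v)).toTopRep).ρ.invariants,
          (C (p : 𝒪) : PowerSeries 𝒪) ^ m • x' = x := by
  refine divisibleInvariants_bigRep_restrict_of_cases κ.toContinuousMonoidHom ρ (localMap K)
    (strictSet p 𝔮 S) hdiv ?_
  rintro (w | w) hv
  · -- decomposition index: `w = 𝔮`
    rw [inl_mem_strictSet_iff] at hv
    subst hv
    exact Or.inl fun a ha hk => hdec a (fun σ => ha σ) hk
  · -- inertia index: `w ∉ Σ`, `w ∤ p`
    rw [inr_mem_strictSet_iff] at hv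
    refine Or.inr ⟨fun h => kappa_localMap_inr_eq_one κ hv.2 h, fun h a => ?_⟩
    obtain ⟨σ, hσ⟩ := h
    exact hunr w hv.1 hv.2 σ hσ a

omit [NumberField K] in
/-- **`hglob` at the specialisation**: the global invariants of `AnticyclotomicBigGaloisRep κ ρ` are
`p^m`-divisible (they vanish) if `A` has no nonzero `Γ_K`-fixed `p`-power torsion
("`H⁰(K, M_g) = H⁰(K_∞, A_g) = 0` … irreducibility of `ρ̄_g|_{G_K}`").
[cite: Castella2018Erratum, Lemma 2.1, proof (p. 2)] -/
theorem divisibleInvariants_anticyclotomicBigGaloisRep (κ : ZpExtension K p)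
    (ρ : ContinuousRep (absoluteGaloisGroup K) 𝒪 A)
    (hA : ∀ a : A, (∀ g : absoluteGaloisGroup K, ρ g a = a) → (∃ k : ℕ, p ^ k • a = 0) → a = 0) :
    ∀ m : ℕ, 1 ≤ m → ∀ x ∈ (AnticyclotomicBigGaloisRep κ ρ).toTopRep.ρ.invariants,
      ∃ x' ∈ (AnticyclotomicBigGaloisRep κ ρ).toTopRep.ρ.invariants,
        (C (p : 𝒪) : PowerSeries 𝒪) ^ m • x' = x :=
  divisibleInvariants_bigRep κ.toContinuousMonoidHom ρ hA

end Generic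

/-! ### §3 The `E`-instance `M_f = W.anticyclotomicBigRep p κ` in the language of geometric points -/

section Curve

variable (W : WeierstrassCurve K) [TopologicalSpace (PowerSeries ℤ_[p])]
  [ContinuousSMul (PowerSeries ℤ_[p]) (BigRepModule ℤ_[p] p (PrimaryTorsion (W.geomPoints) p))]

omit [NumberField K] [Fact p.Prime] [TopologicalSpace (PowerSeries ℤ_[p])]
  [ContinuousSMul (PowerSeries ℤ_[p]) (BigRepModule ℤ_[p] p (PrimaryTorsion (W.geomPoints) p))] in
/-- Every element of `E[p^∞]` is killed by a power of `p` (natural-multiple form). [cite: Serre1968, Ch. I §1.2 (`E_{ℓ^∞} = ⋃ₙ E_{ℓⁿ}`)] -/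
theorem exists_pow_nsmul_primaryTorsion_eq_zero (a : PrimaryTorsion (W.geomPoints) p) :
    ∃ k : ℕ, p ^ k • a = 0 := by
  obtain ⟨k, hk⟩ := a.exists_pow_smul_eq_zero
  exact ⟨k, PrimaryTorsion.ext (by rw [PrimaryTorsion.val_nsmul, hk, PrimaryTorsion.val_zero])⟩

omit [NumberField K] [Fact p.Prime] [TopologicalSpace (PowerSeries ℤ_[p])]
  [ContinuousSMul (PowerSeries ℤ_[p]) (BigRepModule ℤ_[p] p (PrimaryTorsion (W.geomPoints) p))] in
/-- **`p`-divisibility of `E[p^∞]` from `p`-divisibility of `E(K̄)`**: a `p`-th root in `E(K̄)` of a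
`p^k`-torsion point is `p^{k+1}`-torsion. [cite: Serre1968, Ch. I §1.2 (`V_ℓ/T_ℓ = E_{ℓ^∞}` is divisible)] -/
theorem primaryTorsion_divisible_of_geomPoints_divisible
    (hE : ∀ P : W.geomPoints, ∃ Q : W.geomPoints, p • Q = P) :
    ∀ a : PrimaryTorsion (W.geomPoints) p, (∃ k : ℕ, p ^ k • a = 0) →
      ∃ b : PrimaryTorsion (W.geomPoints) p, p • b = a := by
  intro a _
  obtain ⟨k, hk⟩ := a.exists_pow_smul_eq_zero
  obtain ⟨Q, hQ⟩ := hE (a : W.geomPoints)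
  refine ⟨PrimaryTorsion.mk Q (k + 1) (by rw [pow_succ, mul_smul, hQ, hk]), PrimaryTorsion.ext ?_⟩
  rw [PrimaryTorsion.val_nsmul, PrimaryTorsion.val_mk, hQ]

omit [NumberField K] [Fact p.Prime] [TopologicalSpace (PowerSeries ℤ_[p])]
  [ContinuousSMul (PowerSeries ℤ_[p]) (BigRepModule ℤ_[p] p (PrimaryTorsion (W.geomPoints) p))] in
/-- **"No fixed `p`-power torsion" ⟸ "no fixed `p`-torsion"** for any set of group elements acting on
`E(K̄)`: if `P ∈ E[p^∞]` is fixed and nonzero with `p^{k+1} P = 0`, `p^k P ≠ 0` minimal, then `p^k P` is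
a nonzero fixed `p`-torsion point. So the hypotheses of §3 reduce to `E(K)[p] = 0`, `E(K_𝔮)[p] = 0`.
[cite: Castella2018Erratum, Lemma 2.1, proof (p. 2: "vanishes when so does H⁰(K_𝔭, A_g[ϖ])")] -/
theorem eq_zero_of_forall_fixed_of_torsionBy {ι : Type*} (g : ι → absoluteGaloisGroup K)
    (h0 : ∀ P : W.geomPoints, (∀ i, g i • P = P) → p • P = 0 → P = 0)
    (a : PrimaryTorsion (W.geomPoints) p) (ha : ∀ i, g i • a = a) : a = 0 := by
  -- strengthen: every fixed point killed by `p^k` vanishes, by induction on `k`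
  suffices key : ∀ (k : ℕ) (P : W.geomPoints), (∀ i, g i • P = P) → p ^ k • P = 0 → P = 0 by
    obtain ⟨k, hk⟩ := a.exists_pow_smul_eq_zero
    exact PrimaryTorsion.ext (key k (a : W.geomPoints)
      (fun i => by rw [← PrimaryTorsion.val_gsmul, ha i]) hk)
  intro k
  induction k with
  | zero => intro P _ hP; rwa [pow_zero, one_smul] at hP
  | succ k ih =>
    intro P hP hk
    -- `p • P` is fixed and killed by `p^k`, hence zero; then `P` is fixed `p`-torsion
    have hpP : p • P = 0 := ih (p • P) (fun i => by rw [smul_comm, hP i]) (by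
      rw [← mul_smul, ← pow_succ, hk])
    exact h0 P hP hpP

omit [NumberField K] [TopologicalSpace (PowerSeries ℤ_[p])]
  [ContinuousSMul (PowerSeries ℤ_[p]) (BigRepModule ℤ_[p] p (PrimaryTorsion (W.geomPoints) p))] in
/-- **`hdiv` for `M_f = T_pE ⊗ Λ^*`**: `Φ ↦ C(p) • Φ` is onto, from `p`-divisibility of `E(K̄)`.
[cite: Skinner2016PacificMC, §2.3, proof of Lemma 2.3.1 (p. 180: Λ^* divisible)] [cite: Castella2018, §2.1 (𝒜 = T ⊗ Λ^*)] -/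
theorem hdiv_anticyclotomicBigRep (hE : ∀ P : W.geomPoints, ∃ Q : W.geomPoints, p • Q = P) :
    Function.Surjective fun Φ : BigRepModule ℤ_[p] p (PrimaryTorsion (W.geomPoints) p) =>
      (C (p : ℤ_[p]) : PowerSeries ℤ_[p]) • Φ :=
  C_smul_surjective (primaryTorsion_divisible_of_geomPoints_divisible W hE)

omit [NumberField K] in
/-- **`hglob` for `M_f = W.anticyclotomicBigRep p κ`** from "no nonzero `Γ_K`-fixed point of `E[p^∞]`"
(`E(K)[p] = 0`, e.g. from the irreducibility of `E[p]|_{Γ_K}`): the global invariants vanish, hence are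
`p^m`-divisible. [cite: Castella2018Erratum, Lemma 2.1, proof (p. 2: "H⁰(K, M_g) = H⁰(K_∞, A_g) = 0")] -/
theorem hglob_anticyclotomicBigRep (κ : ZpExtension K p)
    (hK : ∀ P : W.geomPoints, (∀ σ : absoluteGaloisGroup K, σ • P = P) → p • P = 0 → P = 0) :
    ∀ m : ℕ, 1 ≤ m → ∀ x ∈ (W.anticyclotomicBigRep p κ).toTopRep.ρ.invariants,
      ∃ x' ∈ (W.anticyclotomicBigRep p κ).toTopRep.ρ.invariants,
        (C (p : ℤ_[p]) : PowerSeries ℤ_[p]) ^ m • x' = x :=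
  divisibleInvariants_anticyclotomicBigGaloisRep κ (W.primaryTorsionGaloisRep p) fun a ha _ =>
    eq_zero_of_forall_fixed_of_torsionBy W (fun σ : absoluteGaloisGroup K => σ) hK a
      fun σ => by simpa only [WeierstrassCurve.primaryTorsionGaloisRep_apply] using ha σ

/-- **`hloc` for `M_f = W.anticyclotomicBigRep p κ`** at `(localMap K, strictSet p 𝔮 Σ)` from
"no nonzero `Γ_{K_𝔮}`-fixed point of `E[p^∞]`" (`E(K_𝔮)[p] = 0` — for `K_𝔮 = ℚ_p` this is (iv)
`E(ℚ_p)[p] = 0`), "inertia at every finite `w ∉ Σ`, `w ∤ p` acts trivially on `E[p^∞]`" (good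
reduction outside `Σ ∪ S_p`, Néron–Ogg–Shafarevich) and `p`-divisibility of `E(K̄)`.
[cite: Castella2018Erratum, Lemma 2.1 and its proof (p. 2)] -/
theorem hloc_anticyclotomicBigRep (κ : ZpExtension K p) (𝔮 : HeightOneSpectrum (𝓞 K))
    (S : Set (HeightOneSpectrum (𝓞 K)))
    (hE : ∀ P : W.geomPoints, ∃ Q : W.geomPoints, p • Q = P)
    (h𝔮 : ∀ P : W.geomPoints, (∀ σ : absoluteGaloisGroup (𝔮.adicCompletion K),
        absGaloisRestrict K (𝔮.adicCompletion K) σ • P = P) → p • P = 0 → P = 0)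
    (hunr : ∀ w : HeightOneSpectrum (𝓞 K), w ∉ S → ((p : ℕ) : 𝓞 K) ∉ w.asIdeal →
      ∀ σ : absoluteGaloisGroup (w.adicCompletion K), σ ∈ absInertia (w.adicCompletion K) →
        ∀ P : PrimaryTorsion (W.geomPoints) p, absGaloisRestrict K (w.adicCompletion K) σ • P = P) :
    ∀ m : ℕ, 1 ≤ m → ∀ v ∈ strictSet p 𝔮 S,
      ∀ x ∈ (((W.anticyclotomicBigRep p κ).restrict (localMap K v)).toTopRep).ρ.invariants,
        ∃ x' ∈ (((W.anticyclotomicBigRep p κ).restrict (localMap K v)).toTopRep).ρ.invariants,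
          (C (p : ℤ_[p]) : PowerSeries ℤ_[p]) ^ m • x' = x :=
  divisibleInvariants_localMap_strictSet κ (W.primaryTorsionGaloisRep p) 𝔮 S
    (primaryTorsion_divisible_of_geomPoints_divisible W hE)
    (fun a ha _ => eq_zero_of_forall_fixed_of_torsionBy W
      (fun σ : absoluteGaloisGroup (𝔮.adicCompletion K) => absGaloisRestrict K (𝔮.adicCompletion K) σ)
      h𝔮 a fun σ => by simpa only [WeierstrassCurve.primaryTorsionGaloisRep_apply] using ha σ)
    (fun w hw hpw σ hσ a => by
      rw [WeierstrassCurve.primaryTorsionGaloisRep_apply]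
      exact hunr w hw hpw σ hσ a)

end Curve

end Summit.BirchSwinnertonDyer.Rank1Residual.X11b.BigRep

end
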